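import Literature.AnabelianGeometry.EtaleTheta.SettingModelYTwist
import Literature.AnabelianGeometry.EtaleTheta.SettingModel2YTwist
import Literature.AnabelianGeometry.EtaleTheta.SettingModel2QNonSquare
import HarnessLib

/-!
# `ThetaSetting.Sec2Hyps`: the independence census in one statement (proof-only summary)

Mochizuki, *The étale theta function …*, Publ. RIMS **45** (2009) [EtTh], Def. 2.5 p. 39 ("`K = K̈`") and §1
p. 13 (the construction of `Y_N`, whence `Π^tp_{Y_N} ⊇ Ker(Π^tp_Y ↠ (Π^tp_Y)^ell)`) [cite: MochizukiEtTh2009, Def 2.5 p.39].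

abc-iut cell, layer L2 / K-L6 slice (bundle `ThetaSetting.Sec2Hyps`, FACT-LIST F-2511), seat abc-iut-w6-d092 (gen 5).
PROOF-ONLY (no `def`): one citable conjunction of the four kernel countermodel theorems of this seat's files
`SettingModelQNonSquare` (`modelQ`), `SettingModelYTwist` (`modelTwist`), `SettingModel2QNonSquare` (`model₂Q`),
`SettingModel2YTwist` (`model₂Twist`): writing (a) := `D.Kdd = D.K`, (b) := `∀ N, Ker(Π^tp_X ↠ (Π^tp_X)^ell) ⊓ Π^tp_Y
≤ Π^tp_{Y_N}`, `hYcl` := the closedness binder of GAP G-w4d021-2, and `guard` := `IsEtThOrigin`,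

* `¬ ∀ D, guard → (b) → (a)` and `¬ ∀ D, guard → (a) → (b)`            (discrete root variants),
* `¬ ∀ D, guard → hYcl → (b) → (a)` and `¬ ∀ D, guard → hYcl → (a) → (b)` (finer root variants),

i.e. NEITHER clause of abc-iut-L2-t8's `Sec2Hyps` is a lemma of the root interface `ThetaSetting p` together with
ALL the other `D`-level standing binders of the §2 consumers; the bundle is an irreducible standing hypothesis
(instances: `ThetaSetting.model_sec2Hyps`, `model₂_sec2Hyps`, the Tate carriers). HONEST LIMITS: statements about OUR
typed interface; `E`-level binders untested (root-vacuous); nothing of [EtTh] asserted or denied; no side taken on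
[IUTchIII] Cor. 3.12.
-/

namespace Literature.AnabelianGeometry.EtaleTheta.ThetaSetting

variable (p : ℕ) [Fact p.Prime]

/-- **Independence census for `Sec2Hyps`** (abc-iut-w6-d092): over the guarded root interface — with or without
the closedness binder `hYcl` — clause (a) "`K = K̈`" does not follow from clause (b)
"`Π^tp_{Y_N} ⊇ Ker(Π^tp_Y ↠ (Π^tp_Y)^ell)`", nor (b) from (a). [cite: MochizukiEtTh2009, Def 2.5 p.39] -/
theorem sec2Hyps_independence_census :
    (¬ ∀ D : ThetaSetting p, D.IsEtThOrigin →
        (∀ N, (D.thetaToEll.comp D.toTheta).ker ⊓ D.GtpY ≤ D.GtpYN N) → D.Kdd = D.K) ∧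
    (¬ ∀ D : ThetaSetting p, D.IsEtThOrigin → D.Kdd = D.K →
        ∀ N, (D.thetaToEll.comp D.toTheta).ker ⊓ D.GtpY ≤ D.GtpYN N) ∧
    (¬ ∀ D : ThetaSetting p, D.IsEtThOrigin →
        (D.DtpY.map D.toHat.toMonoidHom).topologicalClosure ≤
          D.DtpY.map D.toHat.toMonoidHom ⊔ (⁅⁅D.DeltaHat, D.DeltaHat⁆, D.DeltaHat⁆).topologicalClosure →
        (∀ N, (D.thetaToEll.comp D.toTheta).ker ⊓ D.GtpY ≤ D.GtpYN N) → D.Kdd = D.K) ∧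
    (¬ ∀ D : ThetaSetting p, D.IsEtThOrigin →
        (D.DtpY.map D.toHat.toMonoidHom).topologicalClosure ≤
          D.DtpY.map D.toHat.toMonoidHom ⊔ (⁅⁅D.DeltaHat, D.DeltaHat⁆, D.DeltaHat⁆).topologicalClosure →
        D.Kdd = D.K → ∀ N, (D.thetaToEll.comp D.toTheta).ker ⊓ D.GtpY ≤ D.GtpYN N) :=
  ⟨not_forall_Kdd_eq p, not_forall_ker_toEll_inf_GtpY_le_GtpYN p, not_forall_Kdd_eq_of_hYcl p,
    not_forall_ker_toEll_inf_GtpY_le_GtpYN_of_hYcl p⟩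

/-- **Corollary: the bundle is not a theorem of the guarded root with `hYcl`** — `¬ ∀ D, IsEtThOrigin → hYcl →
Sec2Hyps`; yet it is satisfiable there (`ThetaSetting.model₂_sec2Hyps`, abc-iut-L2-d1).
[cite: MochizukiEtTh2009, Def 2.5 p.39] -/
theorem not_forall_sec2Hyps_of_isEtThOrigin_of_hYcl :
    (¬ ∀ D : ThetaSetting p, D.IsEtThOrigin →
        (D.DtpY.map D.toHat.toMonoidHom).topologicalClosure ≤
          D.DtpY.map D.toHat.toMonoidHom ⊔ (⁅⁅D.DeltaHat, D.DeltaHat⁆, D.DeltaHat⁆).topologicalClosure →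
        D.Sec2Hyps) ∧
    ∃ D : ThetaSetting p, D.IsEtThOrigin ∧
        (D.DtpY.map D.toHat.toMonoidHom).topologicalClosure ≤
          D.DtpY.map D.toHat.toMonoidHom ⊔ (⁅⁅D.DeltaHat, D.DeltaHat⁆, D.DeltaHat⁆).topologicalClosure ∧
        D.Sec2Hyps :=
  ⟨fun h => not_sec2Hyps_model₂Twist p (h _ (model₂Twist_isEtThOrigin p) (SettingModel.hYcl_model₂Twist p)),
    ⟨ThetaSetting.model₂ p, model₂_isEtThOrigin p, SettingModel.hYcl_model₂ p, model₂_sec2Hyps p⟩⟩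

end Literature.AnabelianGeometry.EtaleTheta.ThetaSetting
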